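import Literature.MathematicalPhysics.QuantumLattice.FermionBoxTilingPartitionFunction
import Literature.MathematicalPhysics.QuantumLattice.FermionGroundStatesMinimiseMeanEnergy
import HarnessLib

/-!
# Free-boundary partition functions of nested regions: `|log Z_{Λ'} − log Z_Λ − 2(|Λ'| − |Λ|)·log 2| ≤ β·|Λ' ∖ Λ|·S_Ψ`
# (the fill-in step of the thermodynamic limit of the pressure, every translation-covariant finite-range fermion interaction)

Topic `Literature/MathematicalPhysics/QuantumLattice` (family `hubbard`; crew hubbard-fast S2 «T > 0 / families of models»). Companion of
`FermionBoxTilingPartitionFunction` (`log Z_{[0,km)^d}` against `k^d log Z_{[0,m)^d}`): to pass from the boxes `[0,km)^d` to ALL boxes `[0,n)^d`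
one compares nested regions `Λ ⊆ Λ'`. With `H_{Λ'} = Γ(H_Λ) + (far terms) + (cross terms)` (`localHamiltonian_eq_fermionEmbed_add_far_add_cross`),
every far or cross term contains a site of `Λ' ∖ Λ`, each site carries norm mass `≤ S_Ψ` (`sum_filter_mem_norm_le`), `log Z` is `β‖·‖`-Lipschitz,
and `Z_{Λ'}(Γ H_Λ) = 2^{2(|Λ'|−|Λ|)} Z_Λ(H_Λ)` (`log_partitionFn_fermionEmbed`):

* `norm_far_add_cross_le` — `‖far + cross‖ ≤ |Λ' ∖ Λ| · S_Ψ`;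
* **`abs_log_partitionFn_sub_log_partitionFn_sub_le`** — for `Λ ⊆ Λ'`, `β ≥ 0`, `Ψ` Hermitian translation-covariant of finite range `R`:
  `|log Re Z_{Λ'}(H_{Λ'}) − log Re Z_Λ(H_Λ) − 2(|Λ'| − |Λ|) log 2| ≤ β · |Λ' ∖ Λ| · S_Ψ`;
* `abs_log_partitionFn_box_sub_box_le` — the box instance `[0,ℓ)^d ⊆ [0,n)^d` (`ℓ ≤ n`): error `β((n^d − ℓ^d) S_Ψ)`.

Everything is PROVED; no definition, no named fact, no number. NEXT (not here): with `FermionBoxTilingPartitionFunction`, the sequence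
`n^{-d} log Re Z_{[0,n)^d}` is Cauchy, hence the free-boundary pressure `P_free(β,Ψ) = lim_n n^{-d} log Z_{[0,n)^d}` exists for every such `Ψ`.

## Mathlib / tree search

REUSED: `localHamiltonian_eq_fermionEmbed_add_far_add_cross` (`FermionGroundStatesMinimiseMeanEnergy`), `IsTranslationInvariant.sum_filter_mem_norm_le`
(`TranslationInvariantGroundStatesAreMeanEnergyMinimisers`), `sum_le_sum_sum_of_subset_biUnion` (`FermionBoxTilingPartitionFunction`), `log_partitionFn_fermionEmbed`,
`card_orb_polySite` (`FermionLocalHamiltonianCovariance`), `abs_log_partitionFn_sub_log_partitionFn_le`, `localHamiltonian_isHermitian`, `norm_fermionEmbed_le`,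
`card_halfOpenBox`. `lean search 'log_partitionFn.*sub.*card|fill-in'` (2026-08-28): nothing for general interactions.

## References

* O. Bratteli, D. W. Robinson, *OAQSM 2* (1997), §6.2.4 (van Hove limit; boundary terms). [cite: BratteliRobinsonII1997, §6.2.4 (Prop. 6.2.39 ff.)]
* O. Bratteli, A. Kishimoto, D. W. Robinson, Commun. Math. Phys. 64 (1978) 41, §3. [cite: BratteliKishimotoRobinson1978, §3 (H̃_Φ(Λ), W_Φ(Λ), p. 47)]
-/

noncomputable section

open scoped ComplexOrder BigOperators Matrix.Norms.L2Operator
open Finset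

namespace Literature.MathematicalPhysics.QuantumLattice

open Matrix HubbardWave0 Literature.Probability.LatticeModels ThermodynamicLimit

namespace FermionInteraction

variable {d : ℕ} {Ψ : FermionInteraction d} {R : ℝ} {Λ Λ' : Finset (Site d)}

/-- **The far and cross terms are carried by `Λ' ∖ Λ`**: every term of `H_{Λ'}` not inside `Λ` contains a site of `Λ' ∖ Λ`, so
`‖far + cross‖ ≤ |Λ' ∖ Λ| · S_Ψ`. [cite: BratteliKishimotoRobinson1978, §3 (H̃_Φ(Λ), W_Φ(Λ), p. 47)] -/
theorem norm_far_add_cross_le (hT : Ψ.IsTranslationInvariant) (hR : Ψ.HasFiniteRange R) (Λ Λ' : Finset (Site d)) :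
    ‖(∑ X ∈ Λ'.powerset with (¬ X ⊆ Λ ∧ Disjoint X Λ),
          (if h : X ⊆ Λ' then fermionEmbed (PolySite.incl h) (Ψ.Φ X) else 0)) +
        (∑ X ∈ Λ'.powerset with (¬ X ⊆ Λ ∧ ¬ Disjoint X Λ),
          (if h : X ⊆ Λ' then fermionEmbed (PolySite.incl h) (Ψ.Φ X) else 0))‖ ≤
      ((Λ' \ Λ).card : ℝ) * ∑ X ∈ (thicken ({0} : Finset (Site d)) R).powerset with (0 : Site d) ∈ X, ‖Ψ.Φ X‖ := by
  classical
  -- recombine the two sums into the sum over `X ⊆ Λ'`, `X ⊄ Λ`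
  rw [← Finset.filter_filter, ← Finset.filter_filter, Finset.sum_filter_add_sum_filter_not]
  refine (norm_sum_le _ _).trans ?_
  have h1 : ∑ X ∈ Λ'.powerset with ¬ X ⊆ Λ, ‖(if h : X ⊆ Λ' then fermionEmbed (PolySite.incl h) (Ψ.Φ X) else 0)‖ ≤
      ∑ X ∈ Λ'.powerset with ¬ X ⊆ Λ, ‖Ψ.Φ X‖ :=
    Finset.sum_le_sum fun X hX => by
      rw [Finset.mem_filter, Finset.mem_powerset] at hX
      rw [dif_pos hX.1]
      exact norm_fermionEmbed_le _ _
  refine h1.trans ?_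
  -- every such `X` contains a site of `Λ' ∖ Λ`
  have hcover : Λ'.powerset.filter (fun X => ¬ X ⊆ Λ) ⊆
      (Λ' \ Λ).attach.biUnion fun y => Λ'.powerset.filter fun X => (y : Site d) ∈ X := by
    intro X hX
    rw [Finset.mem_filter, Finset.mem_powerset] at hX
    obtain ⟨y, hyX, hyΛ⟩ := Finset.not_subset.1 hX.2
    refine Finset.mem_biUnion.2 ⟨⟨y, Finset.mem_sdiff.2 ⟨hX.1 hyX, hyΛ⟩⟩, Finset.mem_attach _ _, ?_⟩
    exact Finset.mem_filter.2 ⟨Finset.mem_powerset.2 hX.1, hyX⟩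
  have hcover' : Λ'.powerset.filter (fun X => ¬ X ⊆ Λ) ⊆
      (Finset.univ : Finset ↥(Λ' \ Λ)).biUnion fun y => Λ'.powerset.filter fun X => (y : Site d) ∈ X := by
    rw [Finset.univ_eq_attach]; exact hcover
  have h2 := sum_le_sum_sum_of_subset_biUnion (S := Λ'.powerset.filter (fun X => ¬ X ⊆ Λ))
    (fun y : ↥(Λ' \ Λ) => Λ'.powerset.filter fun X => (y : Site d) ∈ X) hcover' (f := fun X => ‖Ψ.Φ X‖)
    fun _ => norm_nonneg _
  refine h2.trans ?_
  refine (Finset.sum_le_sum fun (y : ↥(Λ' \ Λ)) _ => hT.sum_filter_mem_norm_le hR (y : Site d) Λ').trans ?_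
  rw [Finset.sum_const, Finset.card_univ, Fintype.card_coe, nsmul_eq_mul]

/-- **NESTED REGIONS**: for `Λ ⊆ Λ'`, `β ≥ 0` and `Ψ` Hermitian, translation covariant, of finite range `R`:
`|log Re Z_{Λ'}(H_{Λ'}) − log Re Z_Λ(H_Λ) − 2(|Λ'| − |Λ|)·log 2| ≤ β · |Λ' ∖ Λ| · S_Ψ`.
[cite: BratteliRobinsonII1997, §6.2.4 (Prop. 6.2.39 ff.)] [cite: BratteliKishimotoRobinson1978, §3 (H̃_Φ(Λ), W_Φ(Λ), p. 47)] -/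
theorem abs_log_partitionFn_sub_log_partitionFn_sub_le (hH : Ψ.IsHermitian) (hT : Ψ.IsTranslationInvariant)
    (hR : Ψ.HasFiniteRange R) (hΛ : Λ ⊆ Λ') {β : ℝ} (hβ : 0 ≤ β) :
    |Real.log (Matrix.partitionFn β (Ψ.localHamiltonian Λ')).re - Real.log (Matrix.partitionFn β (Ψ.localHamiltonian Λ)).re -
        2 * ((Λ'.card : ℝ) - Λ.card) * Real.log 2| ≤
      β * (((Λ' \ Λ).card : ℝ) * ∑ X ∈ (thicken ({0} : Finset (Site d)) R).powerset with (0 : Site d) ∈ X, ‖Ψ.Φ X‖) := by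
  classical
  haveI : Nonempty (Finset (Orb (PolySite Λ'))) := ⟨∅⟩
  haveI : Nonempty (Finset (Orb (PolySite Λ))) := ⟨∅⟩
  have hdec := Ψ.localHamiltonian_eq_fermionEmbed_add_far_add_cross hΛ
  set A := fermionEmbed (PolySite.incl hΛ) (Ψ.localHamiltonian Λ) with hA
  set V := (∑ X ∈ Λ'.powerset with (¬ X ⊆ Λ ∧ Disjoint X Λ),
          (if h : X ⊆ Λ' then fermionEmbed (PolySite.incl h) (Ψ.Φ X) else 0)) +
        (∑ X ∈ Λ'.powerset with (¬ X ⊆ Λ ∧ ¬ Disjoint X Λ),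
          (if h : X ⊆ Λ' then fermionEmbed (PolySite.incl h) (Ψ.Φ X) else 0)) with hV
  have hHV : Ψ.localHamiltonian Λ' = A + V := by rw [hdec, hA, hV, add_assoc]
  have hAh : A.IsHermitian := by
    rw [hA]; unfold Matrix.IsHermitian; rw [← fermionEmbed_conjTranspose, (localHamiltonian_isHermitian hH Λ).eq]
  have hHh := localHamiltonian_isHermitian hH Λ'
  have hVh : V.IsHermitian := by
    have : V = Ψ.localHamiltonian Λ' - A := by rw [hHV]; abel
    rw [this]; exact hHh.sub hAh
  -- Lipschitz step
  have hLip := abs_log_partitionFn_sub_log_partitionFn_le (hAh.add hVh) hAh hβ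
  rw [add_sub_cancel_left, ← hHV] at hLip
  -- embedding step
  have hemb := log_partitionFn_fermionEmbed (PolySite.incl hΛ) β (localHamiltonian_isHermitian hH Λ)
  rw [← hA, card_orb_polySite, card_orb_polySite] at hemb
  have hcard : (((Λ'.card * 2 - Λ.card * 2 : ℕ)) : ℝ) = 2 * ((Λ'.card : ℝ) - Λ.card) := by
    rw [Nat.cast_sub (Nat.mul_le_mul_right 2 (Finset.card_le_card hΛ))]
    push_cast
    ring
  rw [hcard] at hemb
  have hVn := norm_far_add_cross_le hT hR Λ Λ'
  rw [← hV] at hVn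
  have e : Real.log (Matrix.partitionFn β (Ψ.localHamiltonian Λ')).re - Real.log (Matrix.partitionFn β (Ψ.localHamiltonian Λ)).re -
      2 * ((Λ'.card : ℝ) - Λ.card) * Real.log 2 =
      Real.log (Matrix.partitionFn β (Ψ.localHamiltonian Λ')).re - Real.log (Matrix.partitionFn β A).re := by
    rw [hemb]; ring
  rw [e]
  exact hLip.trans (mul_le_mul_of_nonneg_left hVn hβ)

/-- **Nested boxes** `[0,ℓ)^d ⊆ [0,n)^d` (`ℓ ≤ n`): `|log Re Z_n − log Re Z_ℓ − 2(n^d − ℓ^d) log 2| ≤ β (n^d − ℓ^d) S_Ψ`.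
[cite: BratteliRobinsonII1997, §6.2.4 (Prop. 6.2.39 ff.)] -/
theorem abs_log_partitionFn_box_sub_box_le (hH : Ψ.IsHermitian) (hT : Ψ.IsTranslationInvariant) (hR : Ψ.HasFiniteRange R)
    {ℓ n : ℕ} (hℓn : ℓ ≤ n) {β : ℝ} (hβ : 0 ≤ β) :
    |Real.log (Matrix.partitionFn β (Ψ.localHamiltonian (halfOpenBox d n))).re -
        Real.log (Matrix.partitionFn β (Ψ.localHamiltonian (halfOpenBox d ℓ))).re -
        2 * ((n : ℝ) ^ d - (ℓ : ℝ) ^ d) * Real.log 2| ≤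
      β * (((n : ℝ) ^ d - (ℓ : ℝ) ^ d) * ∑ X ∈ (thicken ({0} : Finset (Site d)) R).powerset with (0 : Site d) ∈ X, ‖Ψ.Φ X‖) := by
  have hsub : halfOpenBox d ℓ ⊆ halfOpenBox d n := by
    intro x hx
    rw [mem_halfOpenBox] at hx ⊢
    intro i
    obtain ⟨h0, h1⟩ := hx i
    exact ⟨h0, h1.trans_le (by exact_mod_cast hℓn)⟩
  have h := abs_log_partitionFn_sub_log_partitionFn_sub_le hH hT hR hsub hβ
  have hc1 : ((halfOpenBox d n).card : ℝ) = (n : ℝ) ^ d := by rw [card_halfOpenBox]; push_cast; ring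
  have hc2 : ((halfOpenBox d ℓ).card : ℝ) = (ℓ : ℝ) ^ d := by rw [card_halfOpenBox]; push_cast; ring
  have hc3 : (((halfOpenBox d n \ halfOpenBox d ℓ).card : ℕ) : ℝ) = (n : ℝ) ^ d - (ℓ : ℝ) ^ d := by
    rw [Finset.card_sdiff_of_subset hsub, Nat.cast_sub (Finset.card_le_card hsub), hc1, hc2]
  rw [hc1, hc2, hc3] at h
  exact h

end FermionInteraction

end Literature.MathematicalPhysics.QuantumLattice

end
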